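import Summits.Ventures.HSemireg.WeilFrameIntrinsic
import Summits.Ventures.HSemireg.Mod4CarrierUpperDegrees
import Summits.Ventures.HSemireg.Mod4CarrierTauForm
import Summits.Ventures.HSemireg.Mod4CarrierEdgeDegrees
import Summits.Ventures.HSemireg.Mod4CarrierOneSided
import Summits.Ventures.HSemireg.Mod4CarrierOneSidedMf

/-!
# Venture HSemireg — THEOREM R_f WITHOUT A FRAME in EVERY degree `0 ≤ k ≤ 2n`: upper side degrees, edge rows, the τ-form of the
# middle degree, and BOTH one-sided columns (`w₋` absent / `w₊` absent) for an abstract Weil datum `(V; L; P, Q; Θ)` of type `(n, n)`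

HONEST FRAMING. Part of the Lean index of the computation cell `pub-hsemireg` (seat w3-mod4-1 gen 9, W3 SPECIAL FIBRES,
MOD4-OFFSPLIT §1 / §12 / §13). Finite-dimensional exterior / linear algebra over a field ONLY: no variety, no cohomology theory, no
semiregularity map is constructed here; nothing here says that HC / HC_CM / HC_AV holds; nothing here is a claim about any explicit
variety; no Literature fact is declared or used; NO definition is introduced.

WHAT IS PROVED. `WeilFrameIntrinsic.lean` (gen 8) transported the LOWER side degrees, the `w₋`-absent one-sided column (lower
degrees) and the MIDDLE degree of THEOREM R_f from an adapted Weil frame `bV` (taken BY VALUE by the carrier files) to an abstract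
Weil datum of type `(n, n)` in characteristic `0` — `dim V = 4n`; `L ⊆ V` of dimension `2n`; disjoint blocks `P`, `Q` of dimension `2n`
with `dim (L ⊓ P) = dim (L ⊓ Q) = n`; `Θ` in the span of the Weil generating set `{x ∧ l : (x ∈ P, l ∈ L ⊓ Q) or (x ∈ Q, l ∈ L ⊓ P)}`
and non-degenerate on `L^⊥`; the class `x = Σ_{m ≤ 2n} (q_m/m!) Θ^m + w₊ + w₋` with `w₊`, `w₋` non-zero members of the top lines
`(⋀^{2n} P).map (ΛP → ΛV)`, `(⋀^{2n} Q).map (ΛQ → ΛV)`. This file does THE SAME for the remaining clauses of the carrier index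
(w3-mod4-1 gen 6 / gen 7: `Mod4CarrierUpperDegrees`, `Mod4CarrierTauForm`, `Mod4CarrierEdgeDegrees`, `Mod4CarrierOneSided`,
`Mod4CarrierOneSidedMf`), so that THEOREM R_f holds for a Weil datum IN EVERY DEGREE `0 ≤ k ≤ 2n` with no frame in any statement:
* `exists_mem_topLine_ne_zero` — the two top lines of a Weil datum contain non-zero vectors (so the one-sided statements below carry
  NO phantom hypothesis about the absent Weil vector);
* **`finrank_S_weilDatum_deg_dual`** — UPPER side degrees `n + 1 ≤ k ≤ 2n - 1` (`k + k' = 2n`, `1 ≤ k' ≤ n - 1`):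
  `dim S_k(x) + 2C(n,k')·r_{k'} = 2C(2n,k') + C(2n,k')·r_{k'}` (palindromy `R_{2n-k'} = R_{k'}`);
* **`finrank_S_weilDatum_zero` / `finrank_S_weilDatum_top`** — EDGE rows `dim S_0(x) = dim S_{2n}(x) = 1` (`n ≥ 1`);
* **`finrank_S_weilDatum_middle_of_sq`** — the τ-FORM of the middle degree: if `(2n)!·(w₊ + w₋)² = 2t·Θ^{2n}` then
  `dim S_n(x) + 2r_n + dim ker(M_f(q) - t) = (r_n + 2)·C(2n,n)` (the eigen-parameter read off the SQUARE of the Weil part);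
* the `w₋`-ABSENT column `x₊ = Σ (q_m/m!) Θ^m + w₊`: **`finrank_S_weilDatum_one_dual`** (upper side degrees),
  **`finrank_S_weilDatum_one_middle`** (middle degree, `+ rank M_f(q)` literally), **`finrank_S_weilDatum_one_zero` / `_one_top`** (edges);
* the `w₊`-ABSENT column `x₋ = Σ (q_m/m!) Θ^m + w₋`: **`finrank_S_weilDatum_low`** (lower side degrees), **`finrank_S_weilDatum_low_dual`**
  (upper), **`finrank_S_weilDatum_low_middle`** (middle, `+ rank M_f(q)`), **`finrank_S_weilDatum_low_zero` / `_low_top`** (edges).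
PROOF = gen 8's dictionary `exists_frame_of_weilDatum` (an adapted frame EXISTS with `w₊ = a·wUp`, `w₋ = b·wLow`, `a, b ≠ 0`,
`Σ (q_m/m!) Θ^m = Ecl bV q (2n)`), after which the carrier theorems apply verbatim. Everything PROVED, 0 sorry.
References: [BourbakiAlgebre1a3] Ch. III §7 no. 8, §11 no. 9; [BuchweitzFlenner2008HH] Prop. 6.4.4 (why these operators).
-/

noncomputable section

open CliffordAlgebra (contractLeft)
open ExteriorAlgebra (ι)
open Module

namespace Summit.Ventures.HSemireg.WeilFrame

open Summit.Ventures.HSemireg.WedgeBridge Summit.Ventures.HSemireg.WeilCarrier Summit.Ventures.HSemireg.Mod4Carrier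
open Summit.Ventures.HSemireg.Wedge.Hankel Summit.Ventures.HSemireg.Wedge.Weil

variable {K : Type*} [Field K] {V : Type*} [AddCommGroup V] [Module K V]

/-! ### 0. The top lines of the two blocks of a Weil datum are non-zero lines -/

/-- **both top lines of a Weil datum of type `(n, n)` contain a non-zero vector** (namely `wUp bV n`, `wLow bV n` of any adapted
frame, which exists by `exists_adapted_basis`). [cite: BourbakiAlgebre1a3, Ch. III §7 no. 8] -/
theorem exists_mem_topLine_ne_zero [FiniteDimensional K V] {n : ℕ} {L P Q : Submodule K V} {Θ : ExteriorAlgebra K V}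
    (hV : finrank K V = (n + n) + (n + n)) (hPQ : Disjoint P Q) (hL : finrank K L = n + n)
    (hLQ : finrank K ↥(L ⊓ Q) = n) (hLP : finrank K ↥(L ⊓ P) = n) (hP : finrank K ↥P = n + n) (hQ : finrank K ↥Q = n + n)
    (hΘ : Θ ∈ Submodule.span K
      {z : ExteriorAlgebra K V | ∃ x l : V, ((x ∈ P ∧ l ∈ L ⊓ Q) ∨ (x ∈ Q ∧ l ∈ L ⊓ P)) ∧ z = ι K x * ι K l})
    (hnd : ∀ l ∈ (L : Set V), ι K l ∈ Submodule.span K {y : ExteriorAlgebra K V |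
      ∃ φ ∈ {θ : Module.Dual K V | ∀ q ∈ L, θ q = 0}, y = contractLeft φ Θ}) :
    (∃ wP : ExteriorAlgebra K V, wP ∈ ((⋀[K]^(finrank K ↥P) ↥P).map (ExteriorAlgebra.map P.subtype).toLinearMap) ∧ wP ≠ 0) ∧
      (∃ wQ : ExteriorAlgebra K V, wQ ∈ ((⋀[K]^(finrank K ↥Q) ↥Q).map (ExteriorAlgebra.map Q.subtype).toLinearMap) ∧ wQ ≠ 0) := by
  obtain ⟨bV, -, hlt, hge, -⟩ := exists_adapted_basis hV L P Q hPQ hL hLQ hLP hΘ hnd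
  have hn : n ≤ n + n := Nat.le_add_right n n
  exact ⟨⟨wUp bV n, wUp_mem_topLine bV hn hP (fun c hc => (hge c hc).1) (fun c hc => (hlt c hc).2), wUp_ne_zero bV hn⟩,
    ⟨wLow bV n, wLow_mem_topLine bV hn hQ (fun c hc => (hlt c hc).1) (fun c hc => (hge c hc).2), wLow_ne_zero bV hn⟩⟩

/-! ### 1. Both Weil vectors alive: upper side degrees, edge rows, τ-form of the middle degree -/

/-- **UPPER side degrees, both Weil vectors alive** (`1 ≤ k'`, `k' + 1 ≤ n`, `k + k' = 2n`): for a Weil datum of type `(n,n)` and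
`x = Σ_{m ≤ 2n} (q_m/m!) Θ^m + w₊ + w₋`,
`dim S_k(x) + (C(n,k') + C(n,k'))·r_{k'}(q) = C(2n,k') + C(2n,k') + C(2n,k')·r_{k'}(q)` — gen 6's `finrank_S_weil_nn_deg_dual`
(palindromy) without a frame. [cite: BuchweitzFlenner2008HH, Prop. 6.4.4] [cite: BourbakiAlgebre1a3, Ch. III §11 no. 9] -/
theorem finrank_S_weilDatum_deg_dual [FiniteDimensional K V] [CharZero K] {n : ℕ} {L P Q : Submodule K V}
    {Θ wP wQ : ExteriorAlgebra K V} (hV : finrank K V = (n + n) + (n + n)) (hPQ : Disjoint P Q)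
    (hL : finrank K L = n + n) (hLQ : finrank K ↥(L ⊓ Q) = n) (hLP : finrank K ↥(L ⊓ P) = n)
    (hP : finrank K ↥P = n + n) (hQ : finrank K ↥Q = n + n) (hΘ : Θ ∈ Submodule.span K
      {z : ExteriorAlgebra K V | ∃ x l : V, ((x ∈ P ∧ l ∈ L ⊓ Q) ∨ (x ∈ Q ∧ l ∈ L ⊓ P)) ∧ z = ι K x * ι K l})
    (hnd : ∀ l ∈ (L : Set V), ι K l ∈ Submodule.span K {y : ExteriorAlgebra K V |
      ∃ φ ∈ {θ : Module.Dual K V | ∀ q ∈ L, θ q = 0}, y = contractLeft φ Θ})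
    (hwP : wP ∈ ((⋀[K]^(finrank K ↥P) ↥P).map (ExteriorAlgebra.map P.subtype).toLinearMap)) (hwP0 : wP ≠ 0)
    (hwQ : wQ ∈ ((⋀[K]^(finrank K ↥Q) ↥Q).map (ExteriorAlgebra.map Q.subtype).toLinearMap)) (hwQ0 : wQ ≠ 0)
    (q : ℕ → K) {k k' : ℕ} (hk1 : 1 ≤ k') (hkn : k' + 1 ≤ n) (hkk : k + k' = n + n) :
    finrank K ↥(S K L k ((∑ m ∈ Finset.range (n + n + 1), (q m * ((m.factorial : ℕ) : K)⁻¹) • Θ ^ m) + wP + wQ)) +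
        (n.choose k' + n.choose k') * (hankel1 K (n + n) k' q).rank =
      (n + n).choose k' + (n + n).choose k' + (n + n).choose k' * (hankel1 K (n + n) k' q).rank := by
  obtain ⟨bV, a, b, ha, hb, hLsp, -, rfl, rfl, hE⟩ :=
    exists_frame_of_weilDatum hV hPQ hL hLQ hLP hP hQ hΘ hnd hwP hwP0 hwQ hwQ0
  rw [← hLsp, hE]
  exact finrank_S_weil_nn_deg_dual bV hk1 hkn hkk q ha hb

/-- **EDGE row, degree `0`, both Weil vectors alive** (`n ≥ 1`): `dim S_0(x) = 1` — gen 7's `finrank_S_weil_nn_zero` without a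
frame. [cite: BuchweitzFlenner2008HH, Prop. 6.4.4] -/
theorem finrank_S_weilDatum_zero [FiniteDimensional K V] [CharZero K] {n : ℕ} {L P Q : Submodule K V}
    {Θ wP wQ : ExteriorAlgebra K V} (hV : finrank K V = (n + n) + (n + n)) (hPQ : Disjoint P Q)
    (hL : finrank K L = n + n) (hLQ : finrank K ↥(L ⊓ Q) = n) (hLP : finrank K ↥(L ⊓ P) = n)
    (hP : finrank K ↥P = n + n) (hQ : finrank K ↥Q = n + n) (hΘ : Θ ∈ Submodule.span K
      {z : ExteriorAlgebra K V | ∃ x l : V, ((x ∈ P ∧ l ∈ L ⊓ Q) ∨ (x ∈ Q ∧ l ∈ L ⊓ P)) ∧ z = ι K x * ι K l})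
    (hnd : ∀ l ∈ (L : Set V), ι K l ∈ Submodule.span K {y : ExteriorAlgebra K V |
      ∃ φ ∈ {θ : Module.Dual K V | ∀ q ∈ L, θ q = 0}, y = contractLeft φ Θ})
    (hwP : wP ∈ ((⋀[K]^(finrank K ↥P) ↥P).map (ExteriorAlgebra.map P.subtype).toLinearMap)) (hwP0 : wP ≠ 0)
    (hwQ : wQ ∈ ((⋀[K]^(finrank K ↥Q) ↥Q).map (ExteriorAlgebra.map Q.subtype).toLinearMap)) (hwQ0 : wQ ≠ 0)
    (hn : 1 ≤ n) (q : ℕ → K) :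
    finrank K ↥(S K L 0 ((∑ m ∈ Finset.range (n + n + 1), (q m * ((m.factorial : ℕ) : K)⁻¹) • Θ ^ m) + wP + wQ)) = 1 := by
  obtain ⟨bV, a, b, ha, -, hLsp, -, rfl, rfl, hE⟩ :=
    exists_frame_of_weilDatum hV hPQ hL hLQ hLP hP hQ hΘ hnd hwP hwP0 hwQ hwQ0
  rw [← hLsp, hE]
  exact finrank_S_weil_nn_zero bV hn q (Or.inl ha)

/-- **EDGE row, top degree `2n`, both Weil vectors alive** (`n ≥ 1`): `dim S_{2n}(x) = 1` — gen 7's `finrank_S_weil_nn_top` without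
a frame. [cite: BuchweitzFlenner2008HH, Prop. 6.4.4] -/
theorem finrank_S_weilDatum_top [FiniteDimensional K V] [CharZero K] {n : ℕ} {L P Q : Submodule K V}
    {Θ wP wQ : ExteriorAlgebra K V} (hV : finrank K V = (n + n) + (n + n)) (hPQ : Disjoint P Q)
    (hL : finrank K L = n + n) (hLQ : finrank K ↥(L ⊓ Q) = n) (hLP : finrank K ↥(L ⊓ P) = n)
    (hP : finrank K ↥P = n + n) (hQ : finrank K ↥Q = n + n) (hΘ : Θ ∈ Submodule.span K
      {z : ExteriorAlgebra K V | ∃ x l : V, ((x ∈ P ∧ l ∈ L ⊓ Q) ∨ (x ∈ Q ∧ l ∈ L ⊓ P)) ∧ z = ι K x * ι K l})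
    (hnd : ∀ l ∈ (L : Set V), ι K l ∈ Submodule.span K {y : ExteriorAlgebra K V |
      ∃ φ ∈ {θ : Module.Dual K V | ∀ q ∈ L, θ q = 0}, y = contractLeft φ Θ})
    (hwP : wP ∈ ((⋀[K]^(finrank K ↥P) ↥P).map (ExteriorAlgebra.map P.subtype).toLinearMap)) (hwP0 : wP ≠ 0)
    (hwQ : wQ ∈ ((⋀[K]^(finrank K ↥Q) ↥Q).map (ExteriorAlgebra.map Q.subtype).toLinearMap)) (hwQ0 : wQ ≠ 0)
    (hn : 1 ≤ n) (q : ℕ → K) :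
    finrank K ↥(S K L (n + n) ((∑ m ∈ Finset.range (n + n + 1), (q m * ((m.factorial : ℕ) : K)⁻¹) • Θ ^ m) + wP + wQ)) = 1 := by
  obtain ⟨bV, a, b, ha, -, hLsp, -, rfl, rfl, hE⟩ :=
    exists_frame_of_weilDatum hV hPQ hL hLQ hLP hP hQ hΘ hnd hwP hwP0 hwQ hwQ0
  rw [← hLsp, hE]
  exact finrank_S_weil_nn_top bV hn q (Or.inl ha)

/-- **MIDDLE degree, τ-FORM** (`n ≥ 1`): if the SQUARE of the Weil part satisfies `(2n)!·(w₊ + w₋)² = (2t)·Θ^{2n}` (i.e.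
`w² = 2t·Θ^{2n}/(2n)!`; geometrically `t = ∫w²/(2D) = (-1)ⁿτ`), then
`dim S_n(x) + 2r_n(q) + dim ker(M_f(q) - t) = (r_n(q) + 2)·C(2n,n)` — gen 6's `finrank_S_weil_nn_middle_of_sq` without a frame.
[cite: BuchweitzFlenner2008HH, Prop. 6.4.4] [cite: BourbakiAlgebre1a3, Ch. III §7] -/
theorem finrank_S_weilDatum_middle_of_sq [FiniteDimensional K V] [CharZero K] {n : ℕ} {L P Q : Submodule K V}
    {Θ wP wQ : ExteriorAlgebra K V} (hV : finrank K V = (n + n) + (n + n)) (hPQ : Disjoint P Q)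
    (hL : finrank K L = n + n) (hLQ : finrank K ↥(L ⊓ Q) = n) (hLP : finrank K ↥(L ⊓ P) = n)
    (hP : finrank K ↥P = n + n) (hQ : finrank K ↥Q = n + n) (hΘ : Θ ∈ Submodule.span K
      {z : ExteriorAlgebra K V | ∃ x l : V, ((x ∈ P ∧ l ∈ L ⊓ Q) ∨ (x ∈ Q ∧ l ∈ L ⊓ P)) ∧ z = ι K x * ι K l})
    (hnd : ∀ l ∈ (L : Set V), ι K l ∈ Submodule.span K {y : ExteriorAlgebra K V |
      ∃ φ ∈ {θ : Module.Dual K V | ∀ q ∈ L, θ q = 0}, y = contractLeft φ Θ})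
    (hwP : wP ∈ ((⋀[K]^(finrank K ↥P) ↥P).map (ExteriorAlgebra.map P.subtype).toLinearMap)) (hwP0 : wP ≠ 0)
    (hwQ : wQ ∈ ((⋀[K]^(finrank K ↥Q) ↥Q).map (ExteriorAlgebra.map Q.subtype).toLinearMap)) (hwQ0 : wQ ≠ 0) (hn : 1 ≤ n)
    (q : ℕ → K) {t : K} (ht : (((n + n).factorial : ℕ) : K) • ((wP + wQ) * (wP + wQ)) = (2 * t) • Θ ^ (n + n)) :
    finrank K ↥(S K L n ((∑ m ∈ Finset.range (n + n + 1), (q m * ((m.factorial : ℕ) : K)⁻¹) • Θ ^ m) + wP + wQ)) +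
        2 * (hankel1 K (n + n) n q).rank +
        finrank K ↥(LinearMap.ker (Matrix.toLin' (Mod4.middleM n q) - t • LinearMap.id)) =
      ((hankel1 K (n + n) n q).rank + 2) * (n + n).choose n := by
  obtain ⟨bV, a, b, ha, hb, hLsp, hT, rfl, rfl, hE⟩ :=
    exists_frame_of_weilDatum hV hPQ hL hLQ hLP hP hQ hΘ hnd hwP hwP0 hwQ hwQ0
  have ht' : (a • wUp bV n + b • wLow bV n) * (a • wUp bV n + b • wLow bV n) = (2 * t) • LMprod bV (n + n) := by
    have hfac : (((n + n).factorial : ℕ) : K) ≠ 0 := Nat.cast_ne_zero.mpr (Nat.factorial_ne_zero _)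
    apply smul_right_injective (ExteriorAlgebra K V) hfac
    dsimp only
    rw [ht, smul_comm, factorial_smul_LMprod_eq_pow, hT]
  rw [← hLsp, hE]
  exact finrank_S_weil_nn_middle_of_sq bV hn q ha hb two_ne_zero ht'

/-! ### 2. The `w₋`-absent column `x₊ = Σ (q_m/m!) Θ^m + w₊`: upper side degrees, middle degree, edges -/

/-- **`w₋`-ABSENT column, UPPER side degrees** (`m' + 1 ≤ n`, `m + m' = 2n`):
`dim S_m(x₊) + C(n,m')·r_{m'}(q) = C(2n,m') + C(2n,m')·r_{m'}(q)` — gen 7's `finrank_S_weil_nn_one_dual` without a frame (and with no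
hypothesis on the absent Weil vector). [cite: BuchweitzFlenner2008HH, Prop. 6.4.4] [cite: BourbakiAlgebre1a3, Ch. III §11 no. 9] -/
theorem finrank_S_weilDatum_one_dual [FiniteDimensional K V] [CharZero K] {n : ℕ} {L P Q : Submodule K V}
    {Θ wP : ExteriorAlgebra K V} (hV : finrank K V = (n + n) + (n + n)) (hPQ : Disjoint P Q)
    (hL : finrank K L = n + n) (hLQ : finrank K ↥(L ⊓ Q) = n) (hLP : finrank K ↥(L ⊓ P) = n)
    (hP : finrank K ↥P = n + n) (hQ : finrank K ↥Q = n + n) (hΘ : Θ ∈ Submodule.span K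
      {z : ExteriorAlgebra K V | ∃ x l : V, ((x ∈ P ∧ l ∈ L ⊓ Q) ∨ (x ∈ Q ∧ l ∈ L ⊓ P)) ∧ z = ι K x * ι K l})
    (hnd : ∀ l ∈ (L : Set V), ι K l ∈ Submodule.span K {y : ExteriorAlgebra K V |
      ∃ φ ∈ {θ : Module.Dual K V | ∀ q ∈ L, θ q = 0}, y = contractLeft φ Θ})
    (hwP : wP ∈ ((⋀[K]^(finrank K ↥P) ↥P).map (ExteriorAlgebra.map P.subtype).toLinearMap)) (hwP0 : wP ≠ 0)
    (q : ℕ → K) {m m' : ℕ} (hmn : m' + 1 ≤ n) (hmm : m + m' = n + n) :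
    finrank K ↥(S K L m ((∑ m ∈ Finset.range (n + n + 1), (q m * ((m.factorial : ℕ) : K)⁻¹) • Θ ^ m) + wP)) +
        n.choose m' * (hankel1 K (n + n) m' q).rank =
      (n + n).choose m' + (n + n).choose m' * (hankel1 K (n + n) m' q).rank := by
  obtain ⟨-, wQ, hwQ, hwQ0⟩ := exists_mem_topLine_ne_zero hV hPQ hL hLQ hLP hP hQ hΘ hnd
  obtain ⟨bV, a, b, ha, -, hLsp, -, rfl, rfl, hE⟩ :=
    exists_frame_of_weilDatum hV hPQ hL hLQ hLP hP hQ hΘ hnd hwP hwP0 hwQ hwQ0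
  rw [← hLsp, hE]
  exact finrank_S_weil_nn_one_dual bV hmn hmm q ha

/-- **`w₋`-ABSENT column, MIDDLE degree with `+ rank M_f(q)` literally** (`n ≥ 1`):
`dim S_n(x₊) + 2r_n(q) + C(2n,n) = C(2n,n)·r_n(q) + 2C(2n,n) + rank M_f(q)` — gen 7's `finrank_S_weil_nn_one_middle_Mf_charZero`
without a frame. [cite: BuchweitzFlenner2008HH, Prop. 6.4.4] -/
theorem finrank_S_weilDatum_one_middle [FiniteDimensional K V] [CharZero K] {n : ℕ} {L P Q : Submodule K V}
    {Θ wP : ExteriorAlgebra K V} (hV : finrank K V = (n + n) + (n + n)) (hPQ : Disjoint P Q)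
    (hL : finrank K L = n + n) (hLQ : finrank K ↥(L ⊓ Q) = n) (hLP : finrank K ↥(L ⊓ P) = n)
    (hP : finrank K ↥P = n + n) (hQ : finrank K ↥Q = n + n) (hΘ : Θ ∈ Submodule.span K
      {z : ExteriorAlgebra K V | ∃ x l : V, ((x ∈ P ∧ l ∈ L ⊓ Q) ∨ (x ∈ Q ∧ l ∈ L ⊓ P)) ∧ z = ι K x * ι K l})
    (hnd : ∀ l ∈ (L : Set V), ι K l ∈ Submodule.span K {y : ExteriorAlgebra K V |
      ∃ φ ∈ {θ : Module.Dual K V | ∀ q ∈ L, θ q = 0}, y = contractLeft φ Θ})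
    (hwP : wP ∈ ((⋀[K]^(finrank K ↥P) ↥P).map (ExteriorAlgebra.map P.subtype).toLinearMap)) (hwP0 : wP ≠ 0)
    (hn : 1 ≤ n) (q : ℕ → K) :
    finrank K ↥(S K L n ((∑ m ∈ Finset.range (n + n + 1), (q m * ((m.factorial : ℕ) : K)⁻¹) • Θ ^ m) + wP)) +
        2 * (hankel1 K (n + n) n q).rank + (n + n).choose n =
      (n + n).choose n * (hankel1 K (n + n) n q).rank + ((n + n).choose n + (n + n).choose n) + (Mod4.middleM n q).rank := by
  obtain ⟨-, wQ, hwQ, hwQ0⟩ := exists_mem_topLine_ne_zero hV hPQ hL hLQ hLP hP hQ hΘ hnd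
  obtain ⟨bV, a, b, ha, -, hLsp, -, rfl, rfl, hE⟩ :=
    exists_frame_of_weilDatum hV hPQ hL hLQ hLP hP hQ hΘ hnd hwP hwP0 hwQ hwQ0
  rw [← hLsp, hE]
  exact finrank_S_weil_nn_one_middle_Mf_charZero bV hn q ha

/-- **`w₋`-ABSENT column, EDGE row `0`** (`n ≥ 1`): `dim S_0(x₊) = 1`. [cite: BuchweitzFlenner2008HH, Prop. 6.4.4] -/
theorem finrank_S_weilDatum_one_zero [FiniteDimensional K V] [CharZero K] {n : ℕ} {L P Q : Submodule K V}
    {Θ wP : ExteriorAlgebra K V} (hV : finrank K V = (n + n) + (n + n)) (hPQ : Disjoint P Q)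
    (hL : finrank K L = n + n) (hLQ : finrank K ↥(L ⊓ Q) = n) (hLP : finrank K ↥(L ⊓ P) = n)
    (hP : finrank K ↥P = n + n) (hQ : finrank K ↥Q = n + n) (hΘ : Θ ∈ Submodule.span K
      {z : ExteriorAlgebra K V | ∃ x l : V, ((x ∈ P ∧ l ∈ L ⊓ Q) ∨ (x ∈ Q ∧ l ∈ L ⊓ P)) ∧ z = ι K x * ι K l})
    (hnd : ∀ l ∈ (L : Set V), ι K l ∈ Submodule.span K {y : ExteriorAlgebra K V |
      ∃ φ ∈ {θ : Module.Dual K V | ∀ q ∈ L, θ q = 0}, y = contractLeft φ Θ})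
    (hwP : wP ∈ ((⋀[K]^(finrank K ↥P) ↥P).map (ExteriorAlgebra.map P.subtype).toLinearMap)) (hwP0 : wP ≠ 0)
    (hn : 1 ≤ n) (q : ℕ → K) :
    finrank K ↥(S K L 0 ((∑ m ∈ Finset.range (n + n + 1), (q m * ((m.factorial : ℕ) : K)⁻¹) • Θ ^ m) + wP)) = 1 := by
  obtain ⟨-, wQ, hwQ, hwQ0⟩ := exists_mem_topLine_ne_zero hV hPQ hL hLQ hLP hP hQ hΘ hnd
  obtain ⟨bV, a, b, ha, -, hLsp, -, rfl, rfl, hE⟩ :=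
    exists_frame_of_weilDatum hV hPQ hL hLQ hLP hP hQ hΘ hnd hwP hwP0 hwQ hwQ0
  rw [← hLsp, hE]
  exact finrank_S_weil_nn_one_zero bV hn q ha

/-- **`w₋`-ABSENT column, EDGE row `2n`** (`n ≥ 1`): `dim S_{2n}(x₊) = 1`. [cite: BuchweitzFlenner2008HH, Prop. 6.4.4] -/
theorem finrank_S_weilDatum_one_top [FiniteDimensional K V] [CharZero K] {n : ℕ} {L P Q : Submodule K V}
    {Θ wP : ExteriorAlgebra K V} (hV : finrank K V = (n + n) + (n + n)) (hPQ : Disjoint P Q)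
    (hL : finrank K L = n + n) (hLQ : finrank K ↥(L ⊓ Q) = n) (hLP : finrank K ↥(L ⊓ P) = n)
    (hP : finrank K ↥P = n + n) (hQ : finrank K ↥Q = n + n) (hΘ : Θ ∈ Submodule.span K
      {z : ExteriorAlgebra K V | ∃ x l : V, ((x ∈ P ∧ l ∈ L ⊓ Q) ∨ (x ∈ Q ∧ l ∈ L ⊓ P)) ∧ z = ι K x * ι K l})
    (hnd : ∀ l ∈ (L : Set V), ι K l ∈ Submodule.span K {y : ExteriorAlgebra K V |
      ∃ φ ∈ {θ : Module.Dual K V | ∀ q ∈ L, θ q = 0}, y = contractLeft φ Θ})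
    (hwP : wP ∈ ((⋀[K]^(finrank K ↥P) ↥P).map (ExteriorAlgebra.map P.subtype).toLinearMap)) (hwP0 : wP ≠ 0)
    (hn : 1 ≤ n) (q : ℕ → K) :
    finrank K ↥(S K L (n + n) ((∑ m ∈ Finset.range (n + n + 1), (q m * ((m.factorial : ℕ) : K)⁻¹) • Θ ^ m) + wP)) = 1 := by
  obtain ⟨-, wQ, hwQ, hwQ0⟩ := exists_mem_topLine_ne_zero hV hPQ hL hLQ hLP hP hQ hΘ hnd
  obtain ⟨bV, a, b, ha, -, hLsp, -, rfl, rfl, hE⟩ :=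
    exists_frame_of_weilDatum hV hPQ hL hLQ hLP hP hQ hΘ hnd hwP hwP0 hwQ hwQ0
  rw [← hLsp, hE]
  exact finrank_S_weil_nn_one_top bV hn q ha

/-! ### 3. The `w₊`-absent column `x₋ = Σ (q_m/m!) Θ^m + w₋`: lower and upper side degrees, middle degree, edges -/

/-- **`w₊`-ABSENT column, LOWER side degrees** (`m + 1 ≤ n`):
`dim S_m(x₋) + C(n,m)·r_m(q) = C(2n,m) + C(2n,m)·r_m(q)` — gen 7's `finrank_S_weil_nn_low` (the `b`-side by the pair half-swap)
without a frame. [cite: BuchweitzFlenner2008HH, Prop. 6.4.4] [cite: BourbakiAlgebre1a3, Ch. III §11 no. 9] -/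
theorem finrank_S_weilDatum_low [FiniteDimensional K V] [CharZero K] {n : ℕ} {L P Q : Submodule K V}
    {Θ wQ : ExteriorAlgebra K V} (hV : finrank K V = (n + n) + (n + n)) (hPQ : Disjoint P Q)
    (hL : finrank K L = n + n) (hLQ : finrank K ↥(L ⊓ Q) = n) (hLP : finrank K ↥(L ⊓ P) = n)
    (hP : finrank K ↥P = n + n) (hQ : finrank K ↥Q = n + n) (hΘ : Θ ∈ Submodule.span K
      {z : ExteriorAlgebra K V | ∃ x l : V, ((x ∈ P ∧ l ∈ L ⊓ Q) ∨ (x ∈ Q ∧ l ∈ L ⊓ P)) ∧ z = ι K x * ι K l})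
    (hnd : ∀ l ∈ (L : Set V), ι K l ∈ Submodule.span K {y : ExteriorAlgebra K V |
      ∃ φ ∈ {θ : Module.Dual K V | ∀ q ∈ L, θ q = 0}, y = contractLeft φ Θ})
    (hwQ : wQ ∈ ((⋀[K]^(finrank K ↥Q) ↥Q).map (ExteriorAlgebra.map Q.subtype).toLinearMap)) (hwQ0 : wQ ≠ 0)
    (q : ℕ → K) {m : ℕ} (hmn : m + 1 ≤ n) :
    finrank K ↥(S K L m ((∑ m ∈ Finset.range (n + n + 1), (q m * ((m.factorial : ℕ) : K)⁻¹) • Θ ^ m) + wQ)) +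
        n.choose m * (hankel1 K (n + n) m q).rank =
      (n + n).choose m + (n + n).choose m * (hankel1 K (n + n) m q).rank := by
  obtain ⟨⟨wP, hwP, hwP0⟩, -⟩ := exists_mem_topLine_ne_zero hV hPQ hL hLQ hLP hP hQ hΘ hnd
  obtain ⟨bV, a, b, -, hb, hLsp, -, rfl, rfl, hE⟩ :=
    exists_frame_of_weilDatum hV hPQ hL hLQ hLP hP hQ hΘ hnd hwP hwP0 hwQ hwQ0
  rw [← hLsp, hE]
  exact finrank_S_weil_nn_low bV hmn q hb

/-- **`w₊`-ABSENT column, UPPER side degrees** (`m' + 1 ≤ n`, `m + m' = 2n`):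
`dim S_m(x₋) + C(n,m')·r_{m'}(q) = C(2n,m') + C(2n,m')·r_{m'}(q)` — gen 7's `finrank_S_weil_nn_low_dual` without a frame.
[cite: BuchweitzFlenner2008HH, Prop. 6.4.4] [cite: BourbakiAlgebre1a3, Ch. III §11 no. 9] -/
theorem finrank_S_weilDatum_low_dual [FiniteDimensional K V] [CharZero K] {n : ℕ} {L P Q : Submodule K V}
    {Θ wQ : ExteriorAlgebra K V} (hV : finrank K V = (n + n) + (n + n)) (hPQ : Disjoint P Q)
    (hL : finrank K L = n + n) (hLQ : finrank K ↥(L ⊓ Q) = n) (hLP : finrank K ↥(L ⊓ P) = n)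
    (hP : finrank K ↥P = n + n) (hQ : finrank K ↥Q = n + n) (hΘ : Θ ∈ Submodule.span K
      {z : ExteriorAlgebra K V | ∃ x l : V, ((x ∈ P ∧ l ∈ L ⊓ Q) ∨ (x ∈ Q ∧ l ∈ L ⊓ P)) ∧ z = ι K x * ι K l})
    (hnd : ∀ l ∈ (L : Set V), ι K l ∈ Submodule.span K {y : ExteriorAlgebra K V |
      ∃ φ ∈ {θ : Module.Dual K V | ∀ q ∈ L, θ q = 0}, y = contractLeft φ Θ})
    (hwQ : wQ ∈ ((⋀[K]^(finrank K ↥Q) ↥Q).map (ExteriorAlgebra.map Q.subtype).toLinearMap)) (hwQ0 : wQ ≠ 0)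
    (q : ℕ → K) {m m' : ℕ} (hmn : m' + 1 ≤ n) (hmm : m + m' = n + n) :
    finrank K ↥(S K L m ((∑ m ∈ Finset.range (n + n + 1), (q m * ((m.factorial : ℕ) : K)⁻¹) • Θ ^ m) + wQ)) +
        n.choose m' * (hankel1 K (n + n) m' q).rank =
      (n + n).choose m' + (n + n).choose m' * (hankel1 K (n + n) m' q).rank := by
  obtain ⟨⟨wP, hwP, hwP0⟩, -⟩ := exists_mem_topLine_ne_zero hV hPQ hL hLQ hLP hP hQ hΘ hnd
  obtain ⟨bV, a, b, -, hb, hLsp, -, rfl, rfl, hE⟩ :=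
    exists_frame_of_weilDatum hV hPQ hL hLQ hLP hP hQ hΘ hnd hwP hwP0 hwQ hwQ0
  rw [← hLsp, hE]
  exact finrank_S_weil_nn_low_dual bV hmn hmm q hb

/-- **`w₊`-ABSENT column, MIDDLE degree with `+ rank M_f(q)` literally** (`n ≥ 1`):
`dim S_n(x₋) + 2r_n(q) + C(2n,n) = C(2n,n)·r_n(q) + 2C(2n,n) + rank M_f(q)` — gen 7's `finrank_S_weil_nn_low_middle_Mf_charZero`
without a frame. [cite: BuchweitzFlenner2008HH, Prop. 6.4.4] -/
theorem finrank_S_weilDatum_low_middle [FiniteDimensional K V] [CharZero K] {n : ℕ} {L P Q : Submodule K V}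
    {Θ wQ : ExteriorAlgebra K V} (hV : finrank K V = (n + n) + (n + n)) (hPQ : Disjoint P Q)
    (hL : finrank K L = n + n) (hLQ : finrank K ↥(L ⊓ Q) = n) (hLP : finrank K ↥(L ⊓ P) = n)
    (hP : finrank K ↥P = n + n) (hQ : finrank K ↥Q = n + n) (hΘ : Θ ∈ Submodule.span K
      {z : ExteriorAlgebra K V | ∃ x l : V, ((x ∈ P ∧ l ∈ L ⊓ Q) ∨ (x ∈ Q ∧ l ∈ L ⊓ P)) ∧ z = ι K x * ι K l})
    (hnd : ∀ l ∈ (L : Set V), ι K l ∈ Submodule.span K {y : ExteriorAlgebra K V |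
      ∃ φ ∈ {θ : Module.Dual K V | ∀ q ∈ L, θ q = 0}, y = contractLeft φ Θ})
    (hwQ : wQ ∈ ((⋀[K]^(finrank K ↥Q) ↥Q).map (ExteriorAlgebra.map Q.subtype).toLinearMap)) (hwQ0 : wQ ≠ 0)
    (hn : 1 ≤ n) (q : ℕ → K) :
    finrank K ↥(S K L n ((∑ m ∈ Finset.range (n + n + 1), (q m * ((m.factorial : ℕ) : K)⁻¹) • Θ ^ m) + wQ)) +
        2 * (hankel1 K (n + n) n q).rank + (n + n).choose n =
      (n + n).choose n * (hankel1 K (n + n) n q).rank + ((n + n).choose n + (n + n).choose n) + (Mod4.middleM n q).rank := by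
  obtain ⟨⟨wP, hwP, hwP0⟩, -⟩ := exists_mem_topLine_ne_zero hV hPQ hL hLQ hLP hP hQ hΘ hnd
  obtain ⟨bV, a, b, -, hb, hLsp, -, rfl, rfl, hE⟩ :=
    exists_frame_of_weilDatum hV hPQ hL hLQ hLP hP hQ hΘ hnd hwP hwP0 hwQ hwQ0
  rw [← hLsp, hE]
  exact finrank_S_weil_nn_low_middle_Mf_charZero bV hn q hb

/-- **`w₊`-ABSENT column, EDGE row `0`** (`n ≥ 1`): `dim S_0(x₋) = 1`. [cite: BuchweitzFlenner2008HH, Prop. 6.4.4] -/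
theorem finrank_S_weilDatum_low_zero [FiniteDimensional K V] [CharZero K] {n : ℕ} {L P Q : Submodule K V}
    {Θ wQ : ExteriorAlgebra K V} (hV : finrank K V = (n + n) + (n + n)) (hPQ : Disjoint P Q)
    (hL : finrank K L = n + n) (hLQ : finrank K ↥(L ⊓ Q) = n) (hLP : finrank K ↥(L ⊓ P) = n)
    (hP : finrank K ↥P = n + n) (hQ : finrank K ↥Q = n + n) (hΘ : Θ ∈ Submodule.span K
      {z : ExteriorAlgebra K V | ∃ x l : V, ((x ∈ P ∧ l ∈ L ⊓ Q) ∨ (x ∈ Q ∧ l ∈ L ⊓ P)) ∧ z = ι K x * ι K l})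
    (hnd : ∀ l ∈ (L : Set V), ι K l ∈ Submodule.span K {y : ExteriorAlgebra K V |
      ∃ φ ∈ {θ : Module.Dual K V | ∀ q ∈ L, θ q = 0}, y = contractLeft φ Θ})
    (hwQ : wQ ∈ ((⋀[K]^(finrank K ↥Q) ↥Q).map (ExteriorAlgebra.map Q.subtype).toLinearMap)) (hwQ0 : wQ ≠ 0)
    (hn : 1 ≤ n) (q : ℕ → K) :
    finrank K ↥(S K L 0 ((∑ m ∈ Finset.range (n + n + 1), (q m * ((m.factorial : ℕ) : K)⁻¹) • Θ ^ m) + wQ)) = 1 := by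
  obtain ⟨⟨wP, hwP, hwP0⟩, -⟩ := exists_mem_topLine_ne_zero hV hPQ hL hLQ hLP hP hQ hΘ hnd
  obtain ⟨bV, a, b, -, hb, hLsp, -, rfl, rfl, hE⟩ :=
    exists_frame_of_weilDatum hV hPQ hL hLQ hLP hP hQ hΘ hnd hwP hwP0 hwQ hwQ0
  rw [← hLsp, hE]
  exact finrank_S_weil_nn_low_zero bV hn q hb

/-- **`w₊`-ABSENT column, EDGE row `2n`** (`n ≥ 1`): `dim S_{2n}(x₋) = 1`. [cite: BuchweitzFlenner2008HH, Prop. 6.4.4] -/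
theorem finrank_S_weilDatum_low_top [FiniteDimensional K V] [CharZero K] {n : ℕ} {L P Q : Submodule K V}
    {Θ wQ : ExteriorAlgebra K V} (hV : finrank K V = (n + n) + (n + n)) (hPQ : Disjoint P Q)
    (hL : finrank K L = n + n) (hLQ : finrank K ↥(L ⊓ Q) = n) (hLP : finrank K ↥(L ⊓ P) = n)
    (hP : finrank K ↥P = n + n) (hQ : finrank K ↥Q = n + n) (hΘ : Θ ∈ Submodule.span K
      {z : ExteriorAlgebra K V | ∃ x l : V, ((x ∈ P ∧ l ∈ L ⊓ Q) ∨ (x ∈ Q ∧ l ∈ L ⊓ P)) ∧ z = ι K x * ι K l})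
    (hnd : ∀ l ∈ (L : Set V), ι K l ∈ Submodule.span K {y : ExteriorAlgebra K V |
      ∃ φ ∈ {θ : Module.Dual K V | ∀ q ∈ L, θ q = 0}, y = contractLeft φ Θ})
    (hwQ : wQ ∈ ((⋀[K]^(finrank K ↥Q) ↥Q).map (ExteriorAlgebra.map Q.subtype).toLinearMap)) (hwQ0 : wQ ≠ 0)
    (hn : 1 ≤ n) (q : ℕ → K) :
    finrank K ↥(S K L (n + n) ((∑ m ∈ Finset.range (n + n + 1), (q m * ((m.factorial : ℕ) : K)⁻¹) • Θ ^ m) + wQ)) = 1 := by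
  obtain ⟨⟨wP, hwP, hwP0⟩, -⟩ := exists_mem_topLine_ne_zero hV hPQ hL hLQ hLP hP hQ hΘ hnd
  obtain ⟨bV, a, b, -, hb, hLsp, -, rfl, rfl, hE⟩ :=
    exists_frame_of_weilDatum hV hPQ hL hLQ hLP hP hQ hΘ hnd hwP hwP0 hwQ hwQ0
  rw [← hLsp, hE]
  exact finrank_S_weil_nn_low_top bV hn q hb

end Summit.Ventures.HSemireg.WeilFrame

end
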